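import Summits.ABC.IUTFork.Cor312LicenceTamePairsExact
import Summits.ABC.IUTFork.Cor312LicenceTameExactRealising
import HarnessLib

/-!
# [IUTchIII] Cor. 3.12, branch C — REALISING pilot ideles with INTEGRAL q-degrees over ARBITRARY tame bad fibres: the (xi-f) licence is
# the PAIR predicate `e_y·(e_w·min(D_w, D_y) + 1) ≤ e_y·P_w + j·e_w·(e_y − 1)` over pairs of BAD places `(w, y)` above one prime

PROOF-ONLY record file (no `def`, no new `Prop`, no instance) of the abc-iut cell (WAVE-4 prover seat abc-iut-w4-d006, gen 5; row
«MIXED-SUMMAND», realising corollary for the R-W WINDOW-TABLE). TAKES NO SIDE on [IUTchIII] Cor. 3.12 or on any author. It is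
abc-iut-w5-d009's `Cor312LicenceTameExactRealising.lean` (p448597, row «GENUINE-WINDOW-EXACT» part 1: uniformly tame bad fibres, via
this seat's p445547) with the uniform-fibre hypothesis REMOVED by this seat's `licence_settingDHVolSharp_iff_of_tame_pairs` (p451223).

THE POINT. For ideles REALISING the pilot divisors (Dupuy–Hilado (3.4): `‖t_{Θ,j,w}‖ = p^{−j²P_q(w)/e_w}`, `‖t_{q,w}‖ = p^{−P_q(w)/e_w}`) with
INTEGRAL q-degrees `P_q(w) = P_w ∈ ℤ_{≥1}` at the bad places, the exponents are integers (`m_Θ = j²·P_w`, `m_q = P_w` at bad `w`; `0` at the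
good places over the same prime, where both ideles are units), so p451223 applies: if every place of `F` over a prime `p` below a bad place
is tame (`p > 2`, `e(x|p) ≤ p − 2` — the indices may DIFFER inside the fibre), then abc-iut-c312-1's `Thm311ToCor312.Licence` at
abc-iut-c312-3's / abc-iut-c312-7's sharp real settings holds **iff** for every such prime `p`, every label `j = i+1 ∈ 𝔽_l^⋇` and every PAIR
of BAD places `w, y | p`:

  `e_y·(e_w·min(D_{j,w}, D_{j,y}) + 1) ≤ e_y·P_w + j·e_w·(e_y − 1)`,   `D_{j,x} := (j²·P_x − 1) div e_x`, `e_x = e(x|p)`.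

Pairs with a GOOD member never fail (`tamePair_of_min_le_neg_one`: a unit idele has level `(0 − 1) div e ≤ −1`), which is why only
bad pairs appear. The pair `y = w` is p448597's predicate `e·((j²P_w − 1) div e) + 1 − j(e−1) ≤ P_w`; pairs `y ≠ w` matter exactly when
two bad places over one prime have DIFFERENT indices (`mixed_summand_strictly_harder_witness`, p448966).

WHAT IS PROVED (namespace `Summit.ABC.IUTFork.Thm311.Real`): **`licence_settingDHVolSharp_iff_of_realises_tame_pairs`**,
**`licence_settingPrVolSharp_iff_of_realises_tame_pairs`**, and — for ANY q-ideles of norm `≤ 1`, via abc-iut-w5-d009's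
`exists_qPinned_and_hull_settingPrVolSharp_iff_licence` — **`exists_qPinned_and_hull_settingPrVolSharp_iff_of_realises_tame_pairs`**
(branch C's per-datum antecedent «∃ ρ qK, QPinned ∧ PilotKummerCompatHull», any columns).
READING (numbers, not adjectives; nothing about print): for the R-W WINDOW-TABLE a datum row whose bad primes `p` all satisfy
`p ≥ e(x|p) + 2` at every `x | p` is DECIDED by finitely many integer comparisons in `(e(w|p), P_w, j)` over pairs of bad places — no
undecided strip, no uniform-fibre proviso. HONEST SCOPE: OUR sharp containers (Θ-regions constant in `m`), Dupuy–Hilado's typed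
(Ind1)/(Ind2) acting independently on every (capsule slot, place) as abc-iut-c312-1 typed Thm. 3.11 (i); the hull-level licence is a
STRONGER-THAN-PRINT form of Step (xi-f) (referee lanes A1/A2); nothing about the printed GLOBAL inequality or the NUMBER-level corollary;
refuted-as-typed ≠ refuted-in-print; nothing asserts or refutes [IUTchIII] Cor. 3.12; typed ≠ proved; instantiated ≠ endorsed.
[cite: Mochizuki2012, IUTchIII Cor. 3.12 p. 173–175, Step (xi) (xi-f) p. 184, Thm. 3.11 (i) p. 154; IUTchIV Prop. 1.1 p. 9, Prop. 1.2 (i)(ii) p. 10]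
[cite: DupuyHilado2025, §3.3, §3.4, §3.9, §4.7, §4.9] [cite: NeukirchANT1999, Ch. II Prop. (5.5), (6.8)] [claim: Mochizuki2012, status: disputed]
for every IUT sentence quoted.
-/

noncomputable section

open Set Function NumberField IsDedekindDomain
open scoped Pointwise

namespace Summit.ABC.IUTFork.Thm311.Real

open Cor312 Cor312.Setting Cor312Vol Cor312Vol.ExplicitDepth Literature.IUT.LogThetaLattice Literature.IUT.LogVolume
open Literature.NumberTheory.NumberFields Literature.NumberTheory.GaloisRepresentations.Ultrametric

variable {F : Type} [Field F] [NumberField F] (X : PilotData F) {logv : PadicLogs F} (hlog : LogvAnalytic logv)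
  (M : Type) [Field M] [NumberField M]
  (archPk : ∀ (j : (thetaIndex X).Label) (vQ : (thetaIndex X).VQ), Set ((logShellsDH X logv).Packet j vQ))
  (archSub : ∀ (j : (thetaIndex X).Label) (v : (thetaIndex X).V),
    Set ((logShellsDH X logv).Packet j ((thetaIndex X).over v)))
  (Ψ : ℤ → ∀ v : (thetaIndex X).V, v ∈ (thetaIndex X).Vbad → Set ((logShellsDH X logv).StarPacket v))
  (act : ℤ → ∀ v : (thetaIndex X).V, v ∈ (thetaIndex X).Vbad →
    (logShellsDH X logv).StarPacket v → Module.End ℚ ((logShellsDH X logv).StarPacket v))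
  (Mmod : ℤ → ∀ j : (thetaIndex X).LabelStar, Set ((logShellsDH X logv).GlobalPacket j.1))
  (region : ℤ → ∀ j : (thetaIndex X).LabelStar, FinDivisor M → ∀ vQ : (thetaIndex X).VQ,
    Set ((logShellsDH X logv).Packet j.1 vQ))
  (n : ℤ) {HT : Type} {LogLink : HT → HT → Type} {IsFull : ∀ {s t : HT}, LogLink s t → Prop}
  (lat : LGPGaussianLogThetaLattice LogLink IsFull)
  {Frd : Type} {IsoF : Frd → Frd → Type} {Ob : Frd → Type} {realify : Frd → Frd} {Strip : Type}
  {IsoS : Strip → Strip → Type} {Mv : ∀ v : (thetaIndex X).V, v ∈ (thetaIndex X).Vbad → Type}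
  [∀ v h, Monoid (Mv v h)]
  (sig : GlobalLGPFrobenioidSignature (thetaIndex X).lstar (thetaIndex X).V (· ∈ (thetaIndex X).Vbad)
    Frd IsoF Ob realify Strip IsoS Mv)
  (split : SplittingMonoids Mv) {ObΔ : Type} {N : ∀ v : (thetaIndex X).V, v ∈ (thetaIndex X).Vbad → Type}
  [∀ v h, Monoid (N v h)] (qData : QPilotData ObΔ N)
  (tq : ∀ (pp : Nat.Primes) (x : (thetaIndex X).Fibre (.inr pp)), haveI : Fact (pp : ℕ).Prime := ⟨pp.2⟩; kOf X pp.1 x)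
  (t : ∀ (pp : Nat.Primes) (_ : Fin X.lstar) (x : (thetaIndex X).Fibre (.inr pp)),
    haveI : Fact (pp : ℕ).Prime := ⟨pp.2⟩; kOf X pp.1 x)
  (htq0 : ∀ pp x, tq pp x ≠ 0)
  (htq1 : ∀ (pp : Nat.Primes) (x : (thetaIndex X).Fibre (.inr pp)),
    haveI : Fact (pp : ℕ).Prime := ⟨pp.2⟩; placeOf X pp.1 x ∉ X.S → ‖tq pp x‖ = 1)
  (col : ℤ → Column (logShellsDH X logv))
  (ht0 : ∀ pp i x, t pp i x ≠ 0)
  (ht : ∀ (pp : Nat.Primes) (i : Fin X.lstar) (x : (thetaIndex X).Fibre (.inr pp)),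
    haveI : Fact (pp : ℕ).Prime := ⟨pp.2⟩
    Real.log ‖t pp i x‖ = -(X.thetaPilot i (placeOf X pp.1 x)) * logNorm F (placeOf X pp.1 x) /
      localDegree F (placeOf X pp.1 x))
  (htq : ∀ (pp : Nat.Primes) (x : (thetaIndex X).Fibre (.inr pp)),
    haveI : Fact (pp : ℕ).Prime := ⟨pp.2⟩
    Real.log ‖tq pp x‖ = -(X.qPilot (placeOf X pp.1 x)) * logNorm F (placeOf X pp.1 x) /
      localDegree F (placeOf X pp.1 x))

/-- The level of a UNIT idele is negative: `(0 − 1) div e < 0` for `e > 0` (so `≤ −1`). [folklore] -/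
theorem level_unit_neg {e : ℤ} (he : 0 < e) : ((0 : ℤ) - 1) / e ≤ -1 := by
  have h1 : e * (((0 : ℤ) - 1) / e) ≤ 0 - 1 := Int.mul_ediv_self_le he.ne'
  have h2 : ((0 : ℤ) - 1) / e < 0 := by
    by_contra h
    rw [not_lt] at h
    nlinarith
  omega

include ht0 ht htq in
/-- **THE (xi-f) LICENCE AT `settingDHVolSharp` FOR REALISING IDELES WITH INTEGRAL q-DEGREES OVER ARBITRARY TAME BAD FIBRES IS THE PAIR
PREDICATE.** Θ- and q-ideles realising the pilot divisors of `X`; at every BAD place `w` the q-degree is a natural number `P_q(w) = P_w` (no positivity needed); every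
place `x` of `F` over a prime `p` below a bad place is tame, `p > 2`, `e(x|p) ≤ p − 2` (NO uniformity inside the fibre). THEN the licence
holds **iff** for every such prime, every label `j = i+1` and every pair of BAD places `w, y | p`:
`e_y·(e_w·min(D_{j,w}, D_{j,y}) + 1) ≤ e_y·P_w + j·e_w·(e_y − 1)`, `D_{j,x} = (j²·P_x − 1) div e(x|p)`. (This seat's
`licence_settingDHVolSharp_iff_of_tame_pairs` with `m_Θ = j²·P`, `m_q = P` at bad places and `0` at good ones; abc-iut-w5-d009's p448597 is the
sub-case of uniform fibres, where only `y = w` matters.) [cite: DupuyHilado2025, §3.3, §3.4, §4.7, §4.9] [cite: NeukirchANT1999, Ch. II Prop. (5.5), (6.8)]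
[claim: Mochizuki2012, status: disputed] -/
theorem licence_settingDHVolSharp_iff_of_realises_tame_pairs
    (htame : ∀ (pp : Nat.Primes) (x : (thetaIndex X).Fibre (.inr pp)),
      haveI : Fact (pp : ℕ).Prime := ⟨pp.2⟩
      (∃ w : (thetaIndex X).Fibre (.inr pp), placeOf X pp.1 w ∈ X.S) →
        2 < (pp : ℕ) ∧ (placeOf X pp.1 x).asIdeal.ramificationIdx ℤ ≤ (pp : ℕ) - 2)
    (P : ∀ pp : Nat.Primes, (thetaIndex X).Fibre (.inr pp) → ℕ)
    (hP : ∀ (pp : Nat.Primes) (w : (thetaIndex X).Fibre (.inr pp)),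
      haveI : Fact (pp : ℕ).Prime := ⟨pp.2⟩; placeOf X pp.1 w ∈ X.S → X.qPilot (placeOf X pp.1 w) = P pp w) :
    Thm311ToCor312.Licence (settingDHVolSharp X hlog M archPk archSub Ψ act Mmod region n lat sig split qData tq t htq0 htq1) ↔
      ∀ (pp : Nat.Primes) (i : Fin (thetaIndex X).lstar) (w y : (thetaIndex X).Fibre (.inr pp)),
        haveI : Fact (pp : ℕ).Prime := ⟨pp.2⟩; placeOf X pp.1 w ∈ X.S → placeOf X pp.1 y ∈ X.S →
          ((placeOf X pp.1 y).asIdeal.ramificationIdx ℤ : ℤ) *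
              (((placeOf X pp.1 w).asIdeal.ramificationIdx ℤ : ℤ) *
                min (((((i : ℕ) + 1 : ℕ) : ℤ) ^ 2 * (P pp w : ℤ) - 1) / ((placeOf X pp.1 w).asIdeal.ramificationIdx ℤ : ℤ))
                  (((((i : ℕ) + 1 : ℕ) : ℤ) ^ 2 * (P pp y : ℤ) - 1) / ((placeOf X pp.1 y).asIdeal.ramificationIdx ℤ : ℤ)) + 1) ≤
            ((placeOf X pp.1 y).asIdeal.ramificationIdx ℤ : ℤ) * (P pp w : ℤ) +
              ((i : ℕ) + 1 : ℕ) * ((placeOf X pp.1 w).asIdeal.ramificationIdx ℤ : ℤ) *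
                (((placeOf X pp.1 y).asIdeal.ramificationIdx ℤ : ℤ) - 1) := by
  classical
  -- uniformizers of the rescaled completions, `‖ϖ_x‖ = p^{−1/e(x|p)}`
  have hex : ∀ (pp : Nat.Primes) (x : (thetaIndex X).Fibre (.inr pp)),
      haveI : Fact (pp : ℕ).Prime := ⟨pp.2⟩
      ∃ ϖ : (kOf X pp.1 x)ˣ, IsUniformizer ϖ ∧ ‖(ϖ : kOf X pp.1 x)‖ =
        ((pp : ℕ) : ℝ) ^ (-(1 / ((placeOf X pp.1 x).asIdeal.ramificationIdx ℤ : ℝ))) := fun pp x => by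
    haveI : Fact (pp : ℕ).Prime := ⟨pp.2⟩
    exact exists_isUniformizer_rescaledCompletion F pp.1 (placeOf X pp.1 x) (natCast_mem_placeOf X pp.1 x)
  choose ϖ hϖ using hex
  -- the norm identities at a bad place `w | p`: `‖t_{Θ,i,w}‖ = ‖ϖ_w‖^{(i+1)²P_w}`, `‖t_{q,w}‖ = ‖ϖ_w‖^{P_w}`
  have key : ∀ (pp : Nat.Primes) (w : (thetaIndex X).Fibre (.inr pp)),
      haveI : Fact (pp : ℕ).Prime := ⟨pp.2⟩
      placeOf X pp.1 w ∈ X.S → ∀ m : ℤ, ∀ c : ℝ, (c : ℝ) = (m : ℝ) →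
        ((pp : ℕ) : ℝ) ^ (-(c * X.qPilot (placeOf X pp.1 w)) / (ramIdx F (placeOf X pp.1 w) : ℝ)) =
          ‖(ϖ pp w : kOf X pp.1 w)‖ ^ (m * (P pp w : ℤ)) := by
    intro pp w hw m c hc
    haveI : Fact (pp : ℕ).Prime := ⟨pp.2⟩
    have hp0 : (0 : ℝ) < ((pp : ℕ) : ℝ) := by exact_mod_cast pp.2.pos
    have hramF : (ramIdx F (placeOf X pp.1 w) : ℝ) = ((placeOf X pp.1 w).asIdeal.ramificationIdx ℤ : ℝ) := by
      rw [ramIdx_eq F (placeOf X pp.1 w)]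
    rw [(hϖ pp w).2, ← Real.rpow_intCast, ← Real.rpow_mul hp0.le, hP pp w hw, hramF, hc]
    congr 1
    push_cast
    ring
  -- the exponents: `(i+1)²·P` and `P` at bad places, `0` at good places
  let mΘ : ∀ pp : Nat.Primes, Fin (thetaIndex X).lstar → (thetaIndex X).Fibre (.inr pp) → ℤ := fun pp i x =>
    haveI : Fact (pp : ℕ).Prime := ⟨pp.2⟩
    if placeOf X pp.1 x ∈ X.S then ((((i : ℕ) + 1 : ℕ) : ℤ) ^ 2 * (P pp x : ℤ)) else 0
  let mq : ∀ pp : Nat.Primes, (thetaIndex X).Fibre (.inr pp) → ℤ := fun pp x =>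
    haveI : Fact (pp : ℕ).Prime := ⟨pp.2⟩
    if placeOf X pp.1 x ∈ X.S then (P pp x : ℤ) else 0
  have hiff := licence_settingDHVolSharp_iff_of_tame_pairs X hlog M archPk archSub Ψ act Mmod region n lat sig split qData tq t htq0
    htq1 (fun pp i x hx => norm_eq_one_of_realises X t ht0 ht pp i x hx)
    (fun pp x => haveI : Fact (pp : ℕ).Prime := ⟨pp.2⟩; (placeOf X pp.1 x).asIdeal.ramificationIdx ℤ) ϖ (fun pp x hS => ?_) mΘ mq
    (fun pp i x hS => ?_)
    (fun pp x hS => ?_)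
  rotate_left
  · -- the tame fibre with its uniformizers
    haveI : Fact (pp : ℕ).Prime := ⟨pp.2⟩
    exact ⟨(htame pp x hS).1, rfl, (htame pp x hS).2, (hϖ pp x).1⟩
  · -- `‖t_{Θ,i,x}‖ = ‖ϖ_x‖^{m_Θ}`
    haveI : Fact (pp : ℕ).Prime := ⟨pp.2⟩
    by_cases hx : placeOf X pp.1 x ∈ X.S
    · show ‖t pp i x‖ = ‖(ϖ pp x : kOf X pp.1 x)‖ ^ (if placeOf X pp.1 x ∈ X.S then ((((i : ℕ) + 1 : ℕ) : ℤ) ^ 2 * (P pp x : ℤ)) else 0)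
      rw [if_pos hx, norm_thetaIdele_eq_rpow_of_realises X tq t htq0 ht0 ht htq pp i x]
      exact key pp x hx _ _ (by push_cast; ring)
    · show ‖t pp i x‖ = ‖(ϖ pp x : kOf X pp.1 x)‖ ^ (if placeOf X pp.1 x ∈ X.S then ((((i : ℕ) + 1 : ℕ) : ℤ) ^ 2 * (P pp x : ℤ)) else 0)
      rw [if_neg hx, zpow_zero, norm_eq_one_of_realises X t ht0 ht pp i x hx]
  · -- `‖t_{q,x}‖ = ‖ϖ_x‖^{m_q}`
    haveI : Fact (pp : ℕ).Prime := ⟨pp.2⟩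
    by_cases hx : placeOf X pp.1 x ∈ X.S
    · show ‖tq pp x‖ = ‖(ϖ pp x : kOf X pp.1 x)‖ ^ (if placeOf X pp.1 x ∈ X.S then (P pp x : ℤ) else 0)
      rw [if_pos hx, norm_qIdele_eq_rpow_of_realises X tq htq0 htq pp x]
      have h := key pp x hx 1 1 (by norm_num)
      rw [one_mul, one_mul] at h
      exact h
    · show ‖tq pp x‖ = ‖(ϖ pp x : kOf X pp.1 x)‖ ^ (if placeOf X pp.1 x ∈ X.S then (P pp x : ℤ) else 0)
      rw [if_neg hx, zpow_zero, htq1 pp x hx]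
  rw [hiff]
  -- the pair predicate with the `if`-exponents ⟺ the pair predicate over BAD pairs
  constructor
  · intro hall pp i w y hw hy
    haveI : Fact (pp : ℕ).Prime := ⟨pp.2⟩
    have h := hall pp i ⟨w, hw⟩ w y
    simp only [mΘ, mq, if_pos hw, if_pos hy] at h
    exact h
  · intro hbad pp i hS w y
    haveI : Fact (pp : ℕ).Prime := ⟨pp.2⟩
    have hE : ∀ x : (thetaIndex X).Fibre (.inr pp), (0 : ℤ) < ((placeOf X pp.1 x).asIdeal.ramificationIdx ℤ : ℤ) := by
      intro x
      rw [← absRamificationIdx_rescaledCompletion F (pp : ℕ) (placeOf X pp.1 x) (natCast_mem_placeOf X pp.1 x)]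
      exact_mod_cast absRamificationIdx_pos _ _
    by_cases hw : placeOf X pp.1 w ∈ X.S
    · by_cases hy : placeOf X pp.1 y ∈ X.S
      · -- both bad: the hypothesis
        have h := hbad pp i w y hw hy
        simp only [mΘ, mq, if_pos hw, if_pos hy]
        exact h
      · -- `y` good: its level is `≤ −1`
        simp only [mΘ, mq, if_pos hw, if_neg hy]
        refine tamePair_of_min_le_neg_one (hE w) (hE y) (by positivity) (by positivity) ?_
        exact (min_le_right _ _).trans (level_unit_neg (hE y))
    · -- `w` good: its level is `≤ −1` and `m_q(w) = 0`
      simp only [mΘ, mq, if_neg hw]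
      refine tamePair_of_min_le_neg_one (hE w) (hE y) le_rfl (by positivity) ?_
      exact (min_le_left _ _).trans (level_unit_neg (hE w))

include ht0 ht htq in
/-- **The same at the print-normalised setting `settingPrVolSharp`** (abc-iut-c312-7; `licence_settingPrVolSharp_iff_settingDHVolSharp`).
[cite: DupuyHilado2025, §3.4, §4.9] [claim: Mochizuki2012, status: disputed] -/
theorem licence_settingPrVolSharp_iff_of_realises_tame_pairs
    (htame : ∀ (pp : Nat.Primes) (x : (thetaIndex X).Fibre (.inr pp)),
      haveI : Fact (pp : ℕ).Prime := ⟨pp.2⟩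
      (∃ w : (thetaIndex X).Fibre (.inr pp), placeOf X pp.1 w ∈ X.S) →
        2 < (pp : ℕ) ∧ (placeOf X pp.1 x).asIdeal.ramificationIdx ℤ ≤ (pp : ℕ) - 2)
    (P : ∀ pp : Nat.Primes, (thetaIndex X).Fibre (.inr pp) → ℕ)
    (hP : ∀ (pp : Nat.Primes) (w : (thetaIndex X).Fibre (.inr pp)),
      haveI : Fact (pp : ℕ).Prime := ⟨pp.2⟩; placeOf X pp.1 w ∈ X.S → X.qPilot (placeOf X pp.1 w) = P pp w) :
    Thm311ToCor312.Licence (settingPrVolSharp X hlog M archPk archSub Ψ act Mmod region n lat sig split qData tq t htq0 htq1) ↔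
      ∀ (pp : Nat.Primes) (i : Fin (thetaIndex X).lstar) (w y : (thetaIndex X).Fibre (.inr pp)),
        haveI : Fact (pp : ℕ).Prime := ⟨pp.2⟩; placeOf X pp.1 w ∈ X.S → placeOf X pp.1 y ∈ X.S →
          ((placeOf X pp.1 y).asIdeal.ramificationIdx ℤ : ℤ) *
              (((placeOf X pp.1 w).asIdeal.ramificationIdx ℤ : ℤ) *
                min (((((i : ℕ) + 1 : ℕ) : ℤ) ^ 2 * (P pp w : ℤ) - 1) / ((placeOf X pp.1 w).asIdeal.ramificationIdx ℤ : ℤ))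
                  (((((i : ℕ) + 1 : ℕ) : ℤ) ^ 2 * (P pp y : ℤ) - 1) / ((placeOf X pp.1 y).asIdeal.ramificationIdx ℤ : ℤ)) + 1) ≤
            ((placeOf X pp.1 y).asIdeal.ramificationIdx ℤ : ℤ) * (P pp w : ℤ) +
              ((i : ℕ) + 1 : ℕ) * ((placeOf X pp.1 w).asIdeal.ramificationIdx ℤ : ℤ) *
                (((placeOf X pp.1 y).asIdeal.ramificationIdx ℤ : ℤ) - 1) := by
  rw [licence_settingPrVolSharp_iff_settingDHVolSharp]
  exact licence_settingDHVolSharp_iff_of_realises_tame_pairs X hlog M archPk archSub Ψ act Mmod region n lat sig split qData tq t htq0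
    htq1 ht0 ht htq htame P hP

include ht0 ht htq in
/-- **BRANCH C's PER-DATUM ANTECEDENT «∃ ρ qK, QPinned ∧ PilotKummerCompatHull» FOR REALISING IDELES WITH INTEGRAL q-DEGREES OVER ARBITRARY
TAME BAD FIBRES IS THE PAIR PREDICATE** (any columns `col`; realising q-ideles have norm `≤ 1`, abc-iut-w5-d009's
`exists_qPinned_and_hull_settingPrVolSharp_iff_licence`). [cite: DupuyHilado2025, §3.3, §3.4, §4.9] [claim: Mochizuki2012, status: disputed] -/
theorem exists_qPinned_and_hull_settingPrVolSharp_iff_of_realises_tame_pairs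
    (htame : ∀ (pp : Nat.Primes) (x : (thetaIndex X).Fibre (.inr pp)),
      haveI : Fact (pp : ℕ).Prime := ⟨pp.2⟩
      (∃ w : (thetaIndex X).Fibre (.inr pp), placeOf X pp.1 w ∈ X.S) →
        2 < (pp : ℕ) ∧ (placeOf X pp.1 x).asIdeal.ramificationIdx ℤ ≤ (pp : ℕ) - 2)
    (P : ∀ pp : Nat.Primes, (thetaIndex X).Fibre (.inr pp) → ℕ)
    (hP : ∀ (pp : Nat.Primes) (w : (thetaIndex X).Fibre (.inr pp)),
      haveI : Fact (pp : ℕ).Prime := ⟨pp.2⟩; placeOf X pp.1 w ∈ X.S → X.qPilot (placeOf X pp.1 w) = P pp w) :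
    (∃ (ρ : (∀ v : (thetaIndex X).V, v ∈ (thetaIndex X).Vbad → Set ((logShellsDH X logv).StarPacket v)) →
          ∀ (j : (thetaIndex X).Label) (vQ : (thetaIndex X).VQ), Set ((logShellsDH X logv).Packet j vQ))
        (qK : ∀ v : (thetaIndex X).V, v ∈ (thetaIndex X).Vbad → Set ((logShellsDH X logv).StarPacket v)),
        QPinned ({ toSituation := situationPrVol X hlog M archPk archSub Ψ act Mmod region, col := col } :
            LatticeSituation (thetaIndex X))
          (settingPrVolSharp X hlog M archPk archSub Ψ act Mmod region n lat sig split qData tq t htq0 htq1) ρ qK ∧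
        PilotKummerCompatHull ({ toSituation := situationPrVol X hlog M archPk archSub Ψ act Mmod region, col := col } :
            LatticeSituation (thetaIndex X))
          (settingPrVolSharp X hlog M archPk archSub Ψ act Mmod region n lat sig split qData tq t htq0 htq1) ρ qK) ↔
      ∀ (pp : Nat.Primes) (i : Fin (thetaIndex X).lstar) (w y : (thetaIndex X).Fibre (.inr pp)),
        haveI : Fact (pp : ℕ).Prime := ⟨pp.2⟩; placeOf X pp.1 w ∈ X.S → placeOf X pp.1 y ∈ X.S →
          ((placeOf X pp.1 y).asIdeal.ramificationIdx ℤ : ℤ) *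
              (((placeOf X pp.1 w).asIdeal.ramificationIdx ℤ : ℤ) *
                min (((((i : ℕ) + 1 : ℕ) : ℤ) ^ 2 * (P pp w : ℤ) - 1) / ((placeOf X pp.1 w).asIdeal.ramificationIdx ℤ : ℤ))
                  (((((i : ℕ) + 1 : ℕ) : ℤ) ^ 2 * (P pp y : ℤ) - 1) / ((placeOf X pp.1 y).asIdeal.ramificationIdx ℤ : ℤ)) + 1) ≤
            ((placeOf X pp.1 y).asIdeal.ramificationIdx ℤ : ℤ) * (P pp w : ℤ) +
              ((i : ℕ) + 1 : ℕ) * ((placeOf X pp.1 w).asIdeal.ramificationIdx ℤ : ℤ) *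
                (((placeOf X pp.1 y).asIdeal.ramificationIdx ℤ : ℤ) - 1) := by
  rw [exists_qPinned_and_hull_settingPrVolSharp_iff_licence X hlog M archPk archSub Ψ act Mmod region n lat sig split qData tq t htq0
    htq1 col (fun pp x => norm_qIdele_le_one_of_realises X tq htq0 htq pp x)]
  exact licence_settingPrVolSharp_iff_of_realises_tame_pairs X hlog M archPk archSub Ψ act Mmod region n lat sig split qData tq t htq0
    htq1 ht0 ht htq htame P hP

end Summit.ABC.IUTFork.Thm311.Real

end
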